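import Summits.ResolutionOfSingularities.ResolutionOfSingularities.Theses.DefectlessFrames

/-!
# Crux `DefectlessFramesR` (stmt-ResolutionOfSingularities-17921) — the hypothesis `PerfectField k` is load-bearing

Route `ResolutionOfSingularities/DefectlessFrames`, crux `DefectlessFramesR` (defectless separable
re-framing of hypersurface frames along a rank-one zero-dimensional valuation over a PERFECT
field).  `defectlessFramesR_false_without_perfectField` proves that the crux with the single
instance hypothesis `[PerfectField k]` deleted (everything else verbatim) is FALSE.

Witness: `p = 2`, `k = 𝔽₂(u²)` (the subfield of squares of `k' = 𝔽₂(u)`; imperfect), `K = k'(t)`,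
`O` = the `t`-adic valuation ring of `K` (rank one; residue field `k'`, which is algebraic over
`k`, so `O` is zero-dimensional over `k`: `x ≡ c (mod 𝔪)` with `c ∈ k'` gives
`(X² - c²)(x) = (x - c)² ∈ 𝔪` with `c² ∈ k`), and the GENUINE hypersurface frame `n = 1`,
`y₀ = t`, `z = u`, `f = X₁² - u² ≠ 0`: `t` is transcendental over `k`, `k(t, u) = k'(t) = K`, and
`span {f} = ker (aeval (t, u))` (division with remainder by the monic `X₁² - u²`, then comparison
of coefficients in the free `k[T]`-module `k'[T] = k[T] ⊕ u·k[T]`).  The conclusion would give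
`y'₀ ∈ O` transcendental over `k` and `z'` SEPARABLE over `k(y'₀)` with `k(y'₀, z') = K`; then
`u ∈ K` is separable over `k(y'₀)` while `u² ∈ k`, so `u ∈ k(y'₀)` (separable ∩ perfect closure
= base), `u = r(y'₀)/s(y'₀)`, `u² s² = r²` in `k[T]` by transcendence, and leading coefficients
make `u²` a square in `k`, i.e. `u ∈ k = 𝔽₂(u²)` — absurd (`u` has odd `u`-adic value).
Moral for provers: the separability conjunct of the conclusion is reachable ONLY through
perfectness of `k` (over imperfect `k`, `K/k` need not be separably generated); the defect clause
is not even reached by this witness.  No definitions, no facts; kernel-only (cdisprove seat,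
2026-08-17).
-/

set_option linter.dupNamespace false

open scoped Polynomial
open IsDedekindDomain.HeightOneSpectrum

namespace Summit.ResolutionOfSingularities.ResolutionOfSingularities.Theorems

noncomputable section

section Witness

variable (F : Type) [Field F]


/-- `X ∈ F[X]_{(X)}`. [folklore] -/
theorem dfrNegB_X_mem_OX : (RatFunc.X : RatFunc F) ∈ ((Polynomial.idealX F).valuation (RatFunc F)).valuationSubring := by
  rw [Valuation.mem_valuationSubring_iff]
  change ((Polynomial.idealX F).valuation (RatFunc F)) RatFunc.X ≤ 1
  rw [Polynomial.valuation_X_eq_neg_one, ← WithZero.exp_zero, WithZero.exp_le_exp]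
  decide

/-- Polynomials lie in `F[X]_{(X)}`. [folklore] -/
theorem dfrNegB_polynomial_mem_OX (q : F[X]) : algebraMap F[X] (RatFunc F) q ∈ ((Polynomial.idealX F).valuation (RatFunc F)).valuationSubring := by
  rw [Valuation.mem_valuationSubring_iff]
  exact valuation_le_one _ _

/-- Constants lie in `F[X]_{(X)}`. [folklore] -/
theorem dfrNegB_const_mem_OX (c : F) : algebraMap F (RatFunc F) c ∈ ((Polynomial.idealX F).valuation (RatFunc F)).valuationSubring := by
  rw [IsScalarTower.algebraMap_apply F F[X] (RatFunc F)]
  exact dfrNegB_polynomial_mem_OX F _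

/-- The valuation of `OX` is equivalent to the `X`-adic valuation. [folklore] -/
theorem dfrNegB_isEquiv_OX : ((Polynomial.idealX F).valuation (RatFunc F)).IsEquiv ((Polynomial.idealX F).valuation (RatFunc F)).valuationSubring.valuation := Valuation.isEquiv_valuation_valuationSubring _

/-- `F[X]_{(X)}` has rank one. [folklore] -/
theorem dfrNegB_rankOne_OX : Nonempty ((Polynomial.idealX F).valuation (RatFunc F)).valuationSubring.valuation.RankOne := by
  haveI : ((Polynomial.idealX F).valuation (RatFunc F)).valuationSubring.valuation.IsNontrivial := by
    refine ⟨RatFunc.X, ?_, ?_⟩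
    · simp [RatFunc.X_ne_zero]
    · intro h1
      have := ((dfrNegB_isEquiv_OX F).symm.eq_one_iff_eq_one).mp h1
      simp [Polynomial.valuation_X_eq_neg_one] at this
  rw [Valuation.nonempty_rankOne_iff_mulArchimedean]
  haveI h1 : MulArchimedean (MonoidWithZeroHom.ValueGroup₀ (.ofClass ((Polynomial.idealX F).valuation (RatFunc F)))) :=
    MulArchimedean.comap MonoidWithZeroHom.ValueGroup₀.embedding.toMonoidHom
      MonoidWithZeroHom.ValueGroup₀.embedding_strictMono
  exact MulArchimedean.comap ((dfrNegB_isEquiv_OX F).symm.orderMonoidIso).toMonoidHom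
    ((dfrNegB_isEquiv_OX F).symm.orderMonoidIso).strictMono

/-- Every element of `F[X]_{(X)}` is congruent to a constant of `F` modulo the maximal ideal
(the residue field is `F`). [folklore] -/
theorem dfrNegB_exists_const_sub_lt_one (x : RatFunc F) (hx : x ∈ ((Polynomial.idealX F).valuation (RatFunc F)).valuationSubring) :
    ∃ c : F, ((Polynomial.idealX F).valuation (RatFunc F)) (x - algebraMap F (RatFunc F) c) < 1 := by
  rw [Valuation.mem_valuationSubring_iff] at hx
  have hd : x.denom ≠ 0 := RatFunc.denom_ne_zero x
  have hd' : algebraMap F[X] (RatFunc F) x.denom ≠ 0 := RatFunc.algebraMap_ne_zero hd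
  -- the denominator is not divisible by `X`
  have hd0 : x.denom.coeff 0 ≠ 0 := by
    intro h0
    have hXd : Polynomial.X ∣ x.denom := Polynomial.X_dvd_iff.mpr h0
    have hvd : (Polynomial.idealX F).intValuation x.denom < 1 :=
      (intValuation_lt_one_iff_mem _ _).mpr
        (by rw [Polynomial.idealX_span]; exact Ideal.mem_span_singleton.mpr hXd)
    have hXn : ¬ Polynomial.X ∣ x.num := by
      intro hXn
      obtain ⟨a, b, hab⟩ := RatFunc.isCoprime_num_denom x
      have : Polynomial.X ∣ (1 : F[X]) := hab ▸ dvd_add (dvd_mul_of_dvd_right hXn a)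
        (dvd_mul_of_dvd_right hXd b)
      exact Polynomial.not_isUnit_X (isUnit_of_dvd_one this)
    have hvn : (Polynomial.idealX F).intValuation x.num = 1 :=
      intValuation_eq_one_iff.mpr
        (by rw [Polynomial.idealX_span]; exact fun h => hXn (Ideal.mem_span_singleton.mp h))
    have hvx : ((Polynomial.idealX F).valuation (RatFunc F)) x = 1 / (Polynomial.idealX F).intValuation x.denom := by
      conv_lhs => rw [← RatFunc.num_div_denom x]
      rw [map_div₀, valuation_of_algebraMap, valuation_of_algebraMap, hvn]
    have hpos : 0 < (Polynomial.idealX F).intValuation x.denom :=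
      zero_lt_iff.mpr (intValuation_ne_zero _ _ hd)
    have : 1 < ((Polynomial.idealX F).valuation (RatFunc F)) x := by
      rw [hvx, one_div, one_lt_inv₀ hpos]; exact hvd
    exact absurd hx (not_le.mpr this)
  have hvd : (Polynomial.idealX F).intValuation x.denom = 1 :=
    intValuation_eq_one_iff.mpr (by
      rw [Polynomial.idealX_span]
      exact fun h => hd0 (Polynomial.X_dvd_iff.mp (Ideal.mem_span_singleton.mp h)))
  set c : F := x.num.coeff 0 / x.denom.coeff 0 with hc
  refine ⟨c, ?_⟩
  have hx' : x - algebraMap F (RatFunc F) c =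
      algebraMap F[X] (RatFunc F) (x.num - Polynomial.C c * x.denom) / algebraMap F[X] (RatFunc F) x.denom := by
    rw [map_sub, map_mul, sub_div, mul_div_assoc, div_self hd', mul_one,
      IsScalarTower.algebraMap_apply F F[X] (RatFunc F) c, Polynomial.algebraMap_eq, RatFunc.num_div_denom]
  rw [hx', map_div₀, valuation_of_algebraMap, valuation_of_algebraMap, hvd, div_one,
    intValuation_lt_one_iff_mem, Polynomial.idealX_span, Ideal.mem_span_singleton,
    Polynomial.X_dvd_iff]
  simp [hc, div_mul_cancel₀ _ hd0]

end Witness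


/-- `u = X` is not a square in `𝔽₂(u)`: its `u`-adic value `exp (-1)` is not a square. [folklore] -/
theorem dfrNegB_X_ne_sq (w : (RatFunc (ZMod 2))) : w ^ 2 ≠ (RatFunc.X : (RatFunc (ZMod 2))) := by
  intro h
  have hv : (((Polynomial.idealX (ZMod 2)).valuation (RatFunc (ZMod 2))) w) ^ 2 = WithZero.exp (-1 : ℤ) := by
    rw [← map_pow, h, Polynomial.valuation_X_eq_neg_one]
  have hw : ((Polynomial.idealX (ZMod 2)).valuation (RatFunc (ZMod 2))) w ≠ 0 := by
    intro h0
    rw [h0, zero_pow two_ne_zero] at hv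
    exact WithZero.exp_ne_zero hv.symm
  have hl := congrArg WithZero.log hv
  rw [WithZero.log_pow, WithZero.log_exp, nsmul_eq_mul] at hl
  omega

/-- Hence `u ∉ 𝔽₂(u²)`. [folklore] -/
theorem dfrNegB_X_not_mem_sq : (RatFunc.X : (RatFunc (ZMod 2))) ∉ (frobenius (RatFunc (ZMod 2)) 2).fieldRange := fun hmem => by
  obtain ⟨w, hw⟩ := RingHom.mem_fieldRange.mp hmem
  exact dfrNegB_X_ne_sq w (by rw [← hw, frobenius_def])

/-- Division with remainder by the monic-in-`X₁` relation `X₁² - a` in `k[X₀, X₁]`. [folklore] -/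
theorem dfrNegB_div_sq_sub_C {k : Type} [Field k] (a : k) (g : MvPolynomial (Fin (1 + 1)) k) :
    ∃ (q : MvPolynomial (Fin (1 + 1)) k) (r₀ r₁ : Polynomial k),
      g = q * (MvPolynomial.X 1 ^ 2 - MvPolynomial.C a) + Polynomial.aeval (MvPolynomial.X 0) r₀ +
        Polynomial.aeval (MvPolynomial.X 0) r₁ * MvPolynomial.X 1 := by
  induction g using MvPolynomial.induction_on with
  | C c =>
    refine ⟨0, Polynomial.C c, 0, ?_⟩
    simp [MvPolynomial.algebraMap_eq]
  | add p q hp hq =>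
    obtain ⟨q₁, r₀, r₁, rfl⟩ := hp
    obtain ⟨q₂, s₀, s₁, rfl⟩ := hq
    refine ⟨q₁ + q₂, r₀ + s₀, r₁ + s₁, ?_⟩
    simp only [map_add]
    ring
  | mul_X p i hp =>
    obtain ⟨q, r₀, r₁, rfl⟩ := hp
    fin_cases i
    · refine ⟨q * MvPolynomial.X 0, r₀ * Polynomial.X, r₁ * Polynomial.X, ?_⟩
      simp only [Fin.zero_eta, map_mul, Polynomial.aeval_X]
      ring
    · refine ⟨q * MvPolynomial.X 1 + Polynomial.aeval (MvPolynomial.X 0) r₁, Polynomial.C a * r₁, r₀, ?_⟩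
      simp only [Fin.mk_one, map_mul, Polynomial.aeval_C, MvPolynomial.algebraMap_eq]
      ring

/-- **`DefectlessFramesR` minus `[PerfectField k]` is false** (the statement below is the crux
`DefectlessFrames.DefectlessFramesR` with the instance binder `[PerfectField k]` deleted and nothing
else changed): any proof of the crux must use perfectness of `k`.  Over the IMPERFECT ground
field `k = 𝔽₂(u²)` take `k' = 𝔽₂(u) = k(u)` (purely inseparable of degree 2), `K = k'(t)`,
`O` = the `t`-adic valuation ring of `K` (rank one; residue field `k'`, algebraic over `k`), and
the genuine hypersurface frame `n = 1`, `y₀ = t`, `z = u`, `f = X₁² - u² ≠ 0` (`k(t, u) = K`,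
`span {f} = ker`).  The conclusion would give `y'₀` transcendental over `k` and `z'` SEPARABLE over
`k(y'₀)` with `k(y'₀, z') = K`; then `u` is separable over `k(y'₀)` and `u² ∈ k`, so
`u ∈ k(y'₀)`, i.e. `u = P(y'₀)/Q(y'₀)`, `u² Q² = P²` in `k[T]`, and comparing leading
coefficients makes `u²` a square in `k`, i.e. `u ∈ k` — absurd.  (So the separability conjunct is
unreachable without perfectness; defectlessness is not even reached.) [folklore] -/
theorem defectlessFramesR_false_without_perfectField : ¬ (∀ p : ℕ, p.Prime → ∀ (k K : Type) [Field k] [CharP k p] [Field K] [Algebra k K], (⊤ : IntermediateField k K).FG → ∀ O : ValuationSubring K, ∀ hk : (∀ c : k, algebraMap k K c ∈ O), Nonempty O.valuation.RankOne → (∀ x ∈ O, ∃ f : Polynomial k, f ≠ 0 ∧ Polynomial.aeval x f ∈ O.nonunits) → let ρ : k →+* IsLocalRing.ResidueField O := (IsLocalRing.residue O).comp ((algebraMap k K).codRestrict O hk); let axis : (m : ℕ) → (Fin m → O) → MvPolynomial (Fin (m + 1)) k → Polynomial (IsLocalRing.ResidueField O) := fun _ w g => MvPolynomial.eval₂ (Polynomial.C.comp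 ρ) (Fin.snoc (fun j => Polynomial.C (IsLocalRing.residue O (w j))) Polynomial.X) g; ∀ (n : ℕ) (y : Fin n → O) (z : O) (f : MvPolynomial (Fin (n + 1)) k), AlgebraicIndependent k (fun i => (y i : K)) → IntermediateField.adjoin k (Set.range (fun i => (y i : K)) ∪ {(z : K)}) = ⊤ → Ideal.span {f} = RingHom.ker (MvPolynomial.aeval (Fin.snoc (fun i => (y i : K)) (z : K)) : MvPolynomial (Fin (n + 1)) k →ₐ[k] K) → f ≠ 0 → ∃ (y' : Fin n → O) (z' : O) (f' : MvPolynomial (Fin (n + 1)) k), AlgebraicIndependent k (fun i => (y' i : K)) ∧ IsIntegral (Algebra.adjoin k (Set.range fun i => (y' i : K))) (z' : K) ∧ IntermediateField.adjoin k (Set.range (fun i => (y' i : K)) ∪ {(z' : K)}) = ⊤ ∧ Ideal.span {f'} = RingHom.ker (MvPolynomial.aeval (Fin.snoc (fun i => (y' i : K)) (z' : K)) : MvPolynomial (Fin (n + 1)) k →ₐ[k] K) ∧ (∀ i, (y i : K) ∈ Algebra.adjoin k (Set.range (fun i => (y' i : K)) ∪ {(z' : K)})) ∧ (z : K) ∈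 Algebra.adjoin k (Set.range (fun i => (y' i : K)) ∪ {(z' : K)}) ∧ axis n y' f' ≠ 0 ∧ (axis n y f ≠ 0 → (axis n y' f').rootMultiplicity (IsLocalRing.residue O z') ≤ (axis n y f).rootMultiplicity (IsLocalRing.residue O z)) ∧ IsSeparable (IntermediateField.adjoin k (Set.range fun i => (y' i : K))) (z' : K) ∧ ∀ (Ω : Type) [Field Ω] [Algebra K Ω] [IsAlgClosure K Ω] (V : ValuationSubring Ω), V.comap (algebraMap K Ω) = O → let F : Subfield Ω := (IntermediateField.adjoin k (Set.range fun i => (y' i : K))).toSubfield.map (algebraMap K Ω); let Fh : Subfield Ω := (IntermediateField.lift (IntermediateField.fixedField (ValuationSubring.decompositionSubgroup F (V.comap (algebraMap (separableClosure F Ω) Ω))))).toSubfield; let T : Subfield Ω := Fh ⊔ (algebraMap K Ω).fieldRange; Fh ≤ T ∧ 0 < Subfield.relfinrank Fh T ∧ Subfield.relfinrank Fh T = (Literature.AlgebraicGeometry.Resolution.valueSubgroup Fh V).relIndex (Literature.AlgebraicGeometry.Resolution.valueSubgroup T V) * (Literature.AlgebraicGeometry.Resolution.residueSubfield Fh V).relfinrank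 (Literature.AlgebraicGeometry.Resolution.residueSubfield T V)) := by
  intro h
  classical
  haveI : CharP (frobenius (RatFunc (ZMod 2)) 2).fieldRange 2 := (Algebra.charP_iff (frobenius (RatFunc (ZMod 2)) 2).fieldRange (RatFunc (ZMod 2)) 2).mpr inferInstance
  have hsq_mem : ∀ w : (RatFunc (ZMod 2)), w ^ 2 ∈ (frobenius (RatFunc (ZMod 2)) 2).fieldRange := fun w => RingHom.mem_fieldRange.mpr ⟨w, frobenius_def ..⟩
  -- the element `a = u² ∈ k`
  obtain ⟨a, ha_val⟩ : ∃ a : (frobenius (RatFunc (ZMod 2)) 2).fieldRange, (a : (RatFunc (ZMod 2))) = RatFunc.X ^ 2 := ⟨⟨_, hsq_mem _⟩, rfl⟩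
  have ha : algebraMap (frobenius (RatFunc (ZMod 2)) 2).fieldRange (RatFunc (RatFunc (ZMod 2))) a = (algebraMap (RatFunc (ZMod 2)) (RatFunc (RatFunc (ZMod 2))) RatFunc.X) ^ 2 := by
    rw [IsScalarTower.algebraMap_apply (frobenius (RatFunc (ZMod 2)) 2).fieldRange (RatFunc (ZMod 2)) (RatFunc (RatFunc (ZMod 2))), ← map_pow, ← ha_val]
    rfl
  -- constants of `k` lie in `O`
  have hconst : ∀ c : (frobenius (RatFunc (ZMod 2)) 2).fieldRange, algebraMap (frobenius (RatFunc (ZMod 2)) 2).fieldRange (RatFunc (RatFunc (ZMod 2))) c ∈ ((Polynomial.idealX (RatFunc (ZMod 2))).valuation (RatFunc (RatFunc (ZMod 2)))).valuationSubring := fun c => by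
    rw [IsScalarTower.algebraMap_apply (frobenius (RatFunc (ZMod 2)) 2).fieldRange (RatFunc (ZMod 2)) (RatFunc (RatFunc (ZMod 2)))]
    exact dfrNegB_const_mem_OX _ _
  -- zero-dimensional over `k`: `x ≡ c (mod 𝔪)` with `c ∈ k'`, and `(x - c)² = x² - c²`, `c² ∈ k`
  have hzero : ∀ x ∈ ((Polynomial.idealX (RatFunc (ZMod 2))).valuation (RatFunc (RatFunc (ZMod 2)))).valuationSubring, ∃ g : Polynomial (frobenius (RatFunc (ZMod 2)) 2).fieldRange, g ≠ 0 ∧ Polynomial.aeval x g ∈ ((Polynomial.idealX (RatFunc (ZMod 2))).valuation (RatFunc (RatFunc (ZMod 2)))).valuationSubring.nonunits := by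
    intro x hx
    obtain ⟨c, hc⟩ := dfrNegB_exists_const_sub_lt_one _ x hx
    refine ⟨Polynomial.X ^ 2 - Polynomial.C ⟨c ^ 2, hsq_mem c⟩, Polynomial.X_pow_sub_C_ne_zero two_pos _, ?_⟩
    rw [ValuationSubring.mem_nonunits_iff, ← (dfrNegB_isEquiv_OX _).lt_one_iff_lt_one]
    have hx2 : Polynomial.aeval x (Polynomial.X ^ 2 - Polynomial.C (⟨c ^ 2, hsq_mem c⟩ : (frobenius (RatFunc (ZMod 2)) 2).fieldRange)) =
        (x - algebraMap (RatFunc (ZMod 2)) (RatFunc (RatFunc (ZMod 2))) c) ^ 2 := by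
      rw [map_sub, map_pow, Polynomial.aeval_X, Polynomial.aeval_C,
        IsScalarTower.algebraMap_apply (frobenius (RatFunc (ZMod 2)) 2).fieldRange (RatFunc (ZMod 2)) (RatFunc (RatFunc (ZMod 2))), sub_pow_char x _, ← map_pow]
      rfl
    rw [hx2, map_pow]
    exact pow_lt_one₀ zero_le hc two_ne_zero
  -- `(⊤ : IntermediateField k K)` is generated by `t` and `u`
  have hgen : IntermediateField.adjoin (frobenius (RatFunc (ZMod 2)) 2).fieldRange ({(RatFunc.X : RatFunc (RatFunc (ZMod 2)))} ∪ {(algebraMap (RatFunc (ZMod 2)) (RatFunc (RatFunc (ZMod 2))) RatFunc.X)} : Set (RatFunc (RatFunc (ZMod 2)))) = ⊤ := by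
    set A := IntermediateField.adjoin (frobenius (RatFunc (ZMod 2)) 2).fieldRange ({(RatFunc.X : RatFunc (RatFunc (ZMod 2)))} ∪ {(algebraMap (RatFunc (ZMod 2)) (RatFunc (RatFunc (ZMod 2))) RatFunc.X)} : Set (RatFunc (RatFunc (ZMod 2)))) with hA
    have huA : (algebraMap (RatFunc (ZMod 2)) (RatFunc (RatFunc (ZMod 2))) RatFunc.X) ∈ A := IntermediateField.subset_adjoin _ _ (Set.mem_union_right _ rfl)
    have htA : (RatFunc.X : RatFunc (RatFunc (ZMod 2))) ∈ A := IntermediateField.subset_adjoin _ _ (Set.mem_union_left _ rfl)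
    -- every constant of `k' = 𝔽₂(u)` lies in `A`
    have hk' : ∀ c : (RatFunc (ZMod 2)), algebraMap (RatFunc (ZMod 2)) (RatFunc (RatFunc (ZMod 2))) c ∈ A := by
      let T : IntermediateField (ZMod 2) (RatFunc (ZMod 2)) :=
        { (A.toSubfield.comap (algebraMap (RatFunc (ZMod 2)) (RatFunc (RatFunc (ZMod 2))))) with
          algebraMap_mem' := fun r => by
            change algebraMap (RatFunc (ZMod 2)) (RatFunc (RatFunc (ZMod 2))) (algebraMap (ZMod 2) (RatFunc (ZMod 2)) r) ∈ A
            rw [← ZMod.natCast_zmod_val r, map_natCast, map_natCast]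
            exact natCast_mem A _ }
      have hXT : (RatFunc.X : (RatFunc (ZMod 2))) ∈ T := huA
      have hT : (⊤ : IntermediateField (ZMod 2) (RatFunc (ZMod 2))) ≤ T := by
        rw [← RatFunc.adjoin_X]
        exact IntermediateField.adjoin_le_iff.mpr (Set.singleton_subset_iff.mpr hXT)
      intro c
      exact hT (IntermediateField.mem_top (x := c))
    let A' : IntermediateField (RatFunc (ZMod 2)) (RatFunc (RatFunc (ZMod 2))) := { A.toSubfield with algebraMap_mem' := hk' }
    have hA' : (⊤ : IntermediateField (RatFunc (ZMod 2)) (RatFunc (RatFunc (ZMod 2)))) ≤ A' := by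
      rw [← RatFunc.adjoin_X]
      exact IntermediateField.adjoin_le_iff.mpr (Set.singleton_subset_iff.mpr (show (RatFunc.X : RatFunc (RatFunc (ZMod 2))) ∈ A' from htA))
    rw [eq_top_iff]
    intro x _
    exact hA' (IntermediateField.mem_top (x := x))
  have hfg : (⊤ : IntermediateField (frobenius (RatFunc (ZMod 2)) 2).fieldRange (RatFunc (RatFunc (ZMod 2)))).FG := by
    refine ⟨{(RatFunc.X : RatFunc (RatFunc (ZMod 2))), (algebraMap (RatFunc (ZMod 2)) (RatFunc (RatFunc (ZMod 2))) RatFunc.X)}, ?_⟩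
    rw [Finset.coe_insert, Finset.coe_singleton, ← hgen, Set.singleton_union]
  -- specialise the crux
  have h1 := h 2 Nat.prime_two (frobenius (RatFunc (ZMod 2)) 2).fieldRange (RatFunc (RatFunc (ZMod 2))) hfg ((Polynomial.idealX (RatFunc (ZMod 2))).valuation (RatFunc (RatFunc (ZMod 2)))).valuationSubring hconst (dfrNegB_rankOne_OX _) hzero
  -- the frame `(t; u)`, `f = X₁² - a`
  let y : Fin 1 → ((Polynomial.idealX (RatFunc (ZMod 2))).valuation (RatFunc (RatFunc (ZMod 2)))).valuationSubring := fun _ => ⟨(RatFunc.X : RatFunc (RatFunc (ZMod 2))), dfrNegB_X_mem_OX _⟩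
  let z : ((Polynomial.idealX (RatFunc (ZMod 2))).valuation (RatFunc (RatFunc (ZMod 2)))).valuationSubring := ⟨(algebraMap (RatFunc (ZMod 2)) (RatFunc (RatFunc (ZMod 2))) RatFunc.X), dfrNegB_const_mem_OX _ _⟩
  have hy : AlgebraicIndependent (frobenius (RatFunc (ZMod 2)) 2).fieldRange (fun i => ((y i : ((Polynomial.idealX (RatFunc (ZMod 2))).valuation (RatFunc (RatFunc (ZMod 2)))).valuationSubring) : (RatFunc (RatFunc (ZMod 2))))) := by
    rw [algebraicIndependent_singleton_iff (0 : Fin 1)]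
    exact Transcendental.of_tower_top (frobenius (RatFunc (ZMod 2)) 2).fieldRange (RatFunc.transcendental_X (K := (RatFunc (ZMod 2))))
  have hrange : Set.range (fun i => ((y i : ((Polynomial.idealX (RatFunc (ZMod 2))).valuation (RatFunc (RatFunc (ZMod 2)))).valuationSubring) : (RatFunc (RatFunc (ZMod 2))))) = {(RatFunc.X : RatFunc (RatFunc (ZMod 2)))} := Set.range_const
  have hadj : IntermediateField.adjoin (frobenius (RatFunc (ZMod 2)) 2).fieldRange (Set.range (fun i => ((y i : ((Polynomial.idealX (RatFunc (ZMod 2))).valuation (RatFunc (RatFunc (ZMod 2)))).valuationSubring) : (RatFunc (RatFunc (ZMod 2))))) ∪ {((z : ((Polynomial.idealX (RatFunc (ZMod 2))).valuation (RatFunc (RatFunc (ZMod 2)))).valuationSubring) : (RatFunc (RatFunc (ZMod 2))))}) = ⊤ := by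
    rw [hrange]
    exact hgen
  have hv0 : (Fin.snoc (fun i => ((y i : ((Polynomial.idealX (RatFunc (ZMod 2))).valuation (RatFunc (RatFunc (ZMod 2)))).valuationSubring) : (RatFunc (RatFunc (ZMod 2))))) ((z : ((Polynomial.idealX (RatFunc (ZMod 2))).valuation (RatFunc (RatFunc (ZMod 2)))).valuationSubring) : (RatFunc (RatFunc (ZMod 2)))) : Fin (1 + 1) → (RatFunc (RatFunc (ZMod 2)))) 0 = (RatFunc.X : RatFunc (RatFunc (ZMod 2))) := rfl
  have hv1 : (Fin.snoc (fun i => ((y i : ((Polynomial.idealX (RatFunc (ZMod 2))).valuation (RatFunc (RatFunc (ZMod 2)))).valuationSubring) : (RatFunc (RatFunc (ZMod 2))))) ((z : ((Polynomial.idealX (RatFunc (ZMod 2))).valuation (RatFunc (RatFunc (ZMod 2)))).valuationSubring) : (RatFunc (RatFunc (ZMod 2)))) : Fin (1 + 1) → (RatFunc (RatFunc (ZMod 2)))) 1 = (algebraMap (RatFunc (ZMod 2)) (RatFunc (RatFunc (ZMod 2))) RatFunc.X) := rfl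
  have hf0 : MvPolynomial.aeval (Fin.snoc (fun i => ((y i : ((Polynomial.idealX (RatFunc (ZMod 2))).valuation (RatFunc (RatFunc (ZMod 2)))).valuationSubring) : (RatFunc (RatFunc (ZMod 2))))) ((z : ((Polynomial.idealX (RatFunc (ZMod 2))).valuation (RatFunc (RatFunc (ZMod 2)))).valuationSubring) : (RatFunc (RatFunc (ZMod 2)))) : Fin (1 + 1) → (RatFunc (RatFunc (ZMod 2))))
      (MvPolynomial.X 1 ^ 2 - MvPolynomial.C a) = 0 := by
    rw [map_sub, map_pow, MvPolynomial.aeval_X, hv1, MvPolynomial.aeval_C, ha, sub_self]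
  have hker : Ideal.span {MvPolynomial.X 1 ^ 2 - MvPolynomial.C a} =
      RingHom.ker (MvPolynomial.aeval (Fin.snoc (fun i => ((y i : ((Polynomial.idealX (RatFunc (ZMod 2))).valuation (RatFunc (RatFunc (ZMod 2)))).valuationSubring) : (RatFunc (RatFunc (ZMod 2))))) ((z : ((Polynomial.idealX (RatFunc (ZMod 2))).valuation (RatFunc (RatFunc (ZMod 2)))).valuationSubring) : (RatFunc (RatFunc (ZMod 2))))) :
        MvPolynomial (Fin (1 + 1)) (frobenius (RatFunc (ZMod 2)) 2).fieldRange →ₐ[(frobenius (RatFunc (ZMod 2)) 2).fieldRange] (RatFunc (RatFunc (ZMod 2)))) := by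
    apply le_antisymm
    · rw [Ideal.span_le, Set.singleton_subset_iff, SetLike.mem_coe, RingHom.mem_ker]
      exact hf0
    · intro g hg
      rw [RingHom.mem_ker] at hg
      obtain ⟨q, r₀, r₁, rfl⟩ := dfrNegB_div_sq_sub_C a g
      rw [map_add, map_add, map_mul, map_mul, hf0, mul_zero, zero_add, ← Polynomial.aeval_algHom_apply,
        ← Polynomial.aeval_algHom_apply, MvPolynomial.aeval_X, MvPolynomial.aeval_X, hv0, hv1,
        ← Polynomial.aeval_map_algebraMap (RatFunc (ZMod 2)) (RatFunc.X : RatFunc (RatFunc (ZMod 2))) r₀, ← Polynomial.aeval_map_algebraMap (RatFunc (ZMod 2)) (RatFunc.X : RatFunc (RatFunc (ZMod 2))) r₁,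
        RatFunc.aeval_X_left_eq_algebraMap, RatFunc.aeval_X_left_eq_algebraMap,
        IsScalarTower.algebraMap_apply (RatFunc (ZMod 2)) (Polynomial (RatFunc (ZMod 2))) (RatFunc (RatFunc (ZMod 2))), Polynomial.algebraMap_eq, ← map_mul, ← map_add,
        map_eq_zero_iff _ (RatFunc.algebraMap_injective (RatFunc (ZMod 2)))] at hg
      -- hg : r₀' + r₁' * C u = 0 in k'[T]; compare coefficients: r₁ ≠ 0 would put u in k
      have hcoeff : ∀ i, algebraMap (frobenius (RatFunc (ZMod 2)) 2).fieldRange (RatFunc (ZMod 2)) (r₀.coeff i) + algebraMap (frobenius (RatFunc (ZMod 2)) 2).fieldRange (RatFunc (ZMod 2)) (r₁.coeff i) * RatFunc.X = 0 := by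
        intro i
        have := congrArg (fun p => Polynomial.coeff p i) hg
        simpa only [Polynomial.coeff_add, Polynomial.coeff_mul_C, Polynomial.coeff_map,
          Polynomial.coeff_zero] using this
      have hr₁ : r₁ = 0 := by
        refine Polynomial.ext fun i => ?_
        rw [Polynomial.coeff_zero]
        by_contra hne
        have hne' : algebraMap (frobenius (RatFunc (ZMod 2)) 2).fieldRange (RatFunc (ZMod 2)) (r₁.coeff i) ≠ 0 :=
          (map_ne_zero_iff _ (algebraMap (frobenius (RatFunc (ZMod 2)) 2).fieldRange (RatFunc (ZMod 2))).injective).mpr hne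
        apply dfrNegB_X_not_mem_sq
        have hX : (RatFunc.X : (RatFunc (ZMod 2))) = -(algebraMap (frobenius (RatFunc (ZMod 2)) 2).fieldRange (RatFunc (ZMod 2)) (r₀.coeff i)) / algebraMap (frobenius (RatFunc (ZMod 2)) 2).fieldRange (RatFunc (ZMod 2)) (r₁.coeff i) := by
          rw [eq_div_iff hne', mul_comm, eq_neg_iff_add_eq_zero, add_comm]
          exact hcoeff i
        rw [hX]
        exact div_mem (neg_mem (r₀.coeff i).2) (r₁.coeff i).2
      have hr₀ : r₀ = 0 := by
        refine Polynomial.ext fun i => ?_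
        have := hcoeff i
        rw [hr₁, Polynomial.coeff_zero, map_zero, zero_mul, add_zero,
          map_eq_zero_iff _ (algebraMap (frobenius (RatFunc (ZMod 2)) 2).fieldRange (RatFunc (ZMod 2))).injective] at this
        rw [Polynomial.coeff_zero]
        exact this
      simp only [hr₀, hr₁, map_zero, zero_mul, add_zero]
      exact Ideal.mul_mem_left _ q (Ideal.subset_span rfl)
  have hf : (MvPolynomial.X 1 ^ 2 - MvPolynomial.C a : MvPolynomial (Fin (1 + 1)) (frobenius (RatFunc (ZMod 2)) 2).fieldRange) ≠ 0 := by
    intro h0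
    have ha0 : (a : (RatFunc (ZMod 2))) ≠ 0 := by rw [ha_val]; exact pow_ne_zero 2 RatFunc.X_ne_zero
    have := congrArg (MvPolynomial.eval (fun _ : Fin (1 + 1) => (0 : (frobenius (RatFunc (ZMod 2)) 2).fieldRange))) h0
    rw [map_sub, map_pow, MvPolynomial.eval_X, MvPolynomial.eval_C, map_zero, zero_pow two_ne_zero,
      zero_sub, neg_eq_zero] at this
    exact ha0 (by rw [this, ZeroMemClass.coe_zero])
  obtain ⟨y', z', f', hy', -, hadj', -, -, -, -, -, hsep, -⟩ := h1 1 y z _ hy hadj hker hf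
  -- `F₁ = k(y'₀)`, `K = F₁(z')` with `z'` separable, so `u` is separable over `F₁`
  generalize hF₁ : IntermediateField.adjoin (frobenius (RatFunc (ZMod 2)) 2).fieldRange (Set.range fun i => ((y' i : ((Polynomial.idealX (RatFunc (ZMod 2))).valuation (RatFunc (RatFunc (ZMod 2)))).valuationSubring) : (RatFunc (RatFunc (ZMod 2))))) = F₁ at hsep
  have hzt : IntermediateField.adjoin F₁ {((z' : ((Polynomial.idealX (RatFunc (ZMod 2))).valuation (RatFunc (RatFunc (ZMod 2)))).valuationSubring) : (RatFunc (RatFunc (ZMod 2))))} = ⊤ := by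
    rw [← IntermediateField.restrictScalars_eq_top_iff (K := (frobenius (RatFunc (ZMod 2)) 2).fieldRange),
      IntermediateField.restrictScalars_adjoin, eq_top_iff, ← hadj', ← hF₁]
    exact IntermediateField.adjoin.mono _ _ _
      (Set.union_subset_union_left _ (IntermediateField.subset_adjoin _ _))
  haveI hKsep : Algebra.IsSeparable F₁ (IntermediateField.adjoin F₁ {((z' : ((Polynomial.idealX (RatFunc (ZMod 2))).valuation (RatFunc (RatFunc (ZMod 2)))).valuationSubring) : (RatFunc (RatFunc (ZMod 2))))}) :=
    (IntermediateField.isSeparable_adjoin_simple_iff_isSeparable (F := F₁) (E := (RatFunc (RatFunc (ZMod 2))))).mpr hsep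
  have hsepu : IsSeparable F₁ (algebraMap (RatFunc (ZMod 2)) (RatFunc (RatFunc (ZMod 2))) RatFunc.X) := by
    have hu_top : (algebraMap (RatFunc (ZMod 2)) (RatFunc (RatFunc (ZMod 2))) RatFunc.X) ∈ IntermediateField.adjoin F₁ {((z' : ((Polynomial.idealX (RatFunc (ZMod 2))).valuation (RatFunc (RatFunc (ZMod 2)))).valuationSubring) : (RatFunc (RatFunc (ZMod 2))))} := by
      rw [hzt]; exact IntermediateField.mem_top
    exact IntermediateField.isSeparable_of_mem_isSeparable (F := F₁) (E := (RatFunc (RatFunc (ZMod 2)))) hu_top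
  -- `u² = a ∈ k ⊆ F₁`: separable and purely inseparable, hence `u ∈ F₁`
  have huF : (algebraMap (RatFunc (ZMod 2)) (RatFunc (RatFunc (ZMod 2))) RatFunc.X) ∈ F₁ := by
    have h1' : (algebraMap (RatFunc (ZMod 2)) (RatFunc (RatFunc (ZMod 2))) RatFunc.X) ∈ separableClosure F₁ (RatFunc (RatFunc (ZMod 2))) := mem_separableClosure_iff.mpr hsepu
    have h2' : (algebraMap (RatFunc (ZMod 2)) (RatFunc (RatFunc (ZMod 2))) RatFunc.X) ∈ perfectClosure F₁ (RatFunc (RatFunc (ZMod 2))) := by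
      rw [mem_perfectClosure_iff_pow_mem 2]
      refine ⟨1, ⟨algebraMap (frobenius (RatFunc (ZMod 2)) 2).fieldRange F₁ a, ?_⟩⟩
      rw [pow_one, ← IsScalarTower.algebraMap_apply, ha]
    have h3 : (algebraMap (RatFunc (ZMod 2)) (RatFunc (RatFunc (ZMod 2))) RatFunc.X) ∈ separableClosure F₁ (RatFunc (RatFunc (ZMod 2))) ⊓ perfectClosure F₁ (RatFunc (RatFunc (ZMod 2))) :=
      IntermediateField.mem_inf.mpr ⟨h1', h2'⟩
    rw [separableClosure_inf_perfectClosure, IntermediateField.mem_bot] at h3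
    obtain ⟨w, hw⟩ := h3
    rw [← hw]
    exact w.2
  -- `u ∈ k(y'₀)` with `y'₀` transcendental over `k`: write `u = r(y'₀)/s(y'₀)`
  have hy0 : Transcendental (frobenius (RatFunc (ZMod 2)) 2).fieldRange ((y' 0 : ((Polynomial.idealX (RatFunc (ZMod 2))).valuation (RatFunc (RatFunc (ZMod 2)))).valuationSubring) : (RatFunc (RatFunc (ZMod 2)))) :=
    (algebraicIndependent_singleton_iff (0 : Fin 1)).mp hy'
  have hrange' : Set.range (fun i => ((y' i : ((Polynomial.idealX (RatFunc (ZMod 2))).valuation (RatFunc (RatFunc (ZMod 2)))).valuationSubring) : (RatFunc (RatFunc (ZMod 2))))) = {((y' 0 : ((Polynomial.idealX (RatFunc (ZMod 2))).valuation (RatFunc (RatFunc (ZMod 2)))).valuationSubring) : (RatFunc (RatFunc (ZMod 2))))} := by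
    rw [Set.range_unique]; rfl
  rw [← hF₁, hrange', IntermediateField.mem_adjoin_simple_iff] at huF
  obtain ⟨r, s, hrs⟩ := huF
  by_cases hs : Polynomial.aeval ((y' 0 : ((Polynomial.idealX (RatFunc (ZMod 2))).valuation (RatFunc (RatFunc (ZMod 2)))).valuationSubring) : (RatFunc (RatFunc (ZMod 2)))) s = 0
  · rw [hs, div_zero, map_eq_zero_iff _ (algebraMap (RatFunc (ZMod 2)) (RatFunc (RatFunc (ZMod 2)))).injective] at hrs
    exact RatFunc.X_ne_zero hrs
  · -- `a s² = r²` in `k[T]`, so `a = (lc r / lc s)²` is a square in `k`, i.e. `u ∈ k`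
    have hpoly : Polynomial.C a * s ^ 2 - r ^ 2 = 0 := by
      refine (transcendental_iff.mp hy0) _ ?_
      rw [eq_div_iff hs] at hrs
      rw [map_sub, map_mul, map_pow, map_pow, Polynomial.aeval_C, ha, ← mul_pow, hrs, sub_self]
    have hs0 : s ≠ 0 := fun h0 => hs (by rw [h0, map_zero])
    have hlead := congrArg Polynomial.leadingCoeff (sub_eq_zero.mp hpoly)
    rw [Polynomial.leadingCoeff_mul, Polynomial.leadingCoeff_C, Polynomial.leadingCoeff_pow,
      Polynomial.leadingCoeff_pow] at hlead
    have hlc : s.leadingCoeff ≠ 0 := Polynomial.leadingCoeff_ne_zero.mpr hs0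
    have hasq : a = (r.leadingCoeff / s.leadingCoeff) ^ 2 := by
      rw [div_pow, eq_div_iff (pow_ne_zero 2 hlc), hlead]
    apply dfrNegB_X_not_mem_sq
    have hX : (RatFunc.X : (RatFunc (ZMod 2))) = ((r.leadingCoeff / s.leadingCoeff : (frobenius (RatFunc (ZMod 2)) 2).fieldRange) : (RatFunc (ZMod 2))) := by
      have h2 : ((RatFunc.X : (RatFunc (ZMod 2))) - ((r.leadingCoeff / s.leadingCoeff : (frobenius (RatFunc (ZMod 2)) 2).fieldRange) : (RatFunc (ZMod 2)))) ^ 2 = 0 := by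
        rw [sub_pow_char, sub_eq_zero, ← ha_val]
        exact_mod_cast congrArg Subtype.val hasq
      exact sub_eq_zero.mp (pow_eq_zero_iff two_ne_zero |>.mp h2)
    rw [hX]
    exact SetLike.coe_mem _

end

end Summit.ResolutionOfSingularities.ResolutionOfSingularities.Theorems
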